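import Summits.HodgeConjecture.HodgeCM.Model.ThetaHolGerm
import Summits.HodgeConjecture.HodgeCM.Model.ArchSideInstance
import Summits.HodgeConjecture.HodgeCM.Model.AdelicThetaModuleFin_1
import Literature.NumberTheory.Automorphic.UnitaryGroupArchSection
import Literature.NumberTheory.Automorphic.UnitaryGroupArchimedean
import Literature.NumberTheory.Automorphic.UnitaryGroupRestrictedProduct
import Literature.NumberTheory.Automorphic.WeightForms
import Literature.AlgebraicGeometry.ShimuraVarieties.UnitaryBallAutomorphicForms
import HarnessLib

/-!
# FLOOR-0 carriers shared by P4 (`hocc`) and P2 (`hdictE`): the adelic group of `U(V)`, its archimedean factor, and the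
# `(1,0) ⊕ (0,1)` cotangent automorphic forms — CONCRETE function spaces, sorry-free

Cell hodgecm-mathlib (D-0151), FLOOR 0 (human ruling D-0183, director s317/s320/s321); crux item H413 = stmt-HodgeConjecture-24833.  A-plan1 (g17)
19:07:55Z: ONE HOME BY NAME for the carriers that the P4 line `Lines/P4AdmissibleOccursInH1.lean` (A-p13 (g21)) and the P2 line
`Lines/P2ThetaDictionaryExists.lean` (A-p18 (g15)) both quantify over — so that P4's `stub_T1_archFactor` and P2's `stub_U0` are ONE statement
over ONE constant.  DEFINITIONS WITH BODIES + lemmas; 0 proof holes, 0 named facts, no instance, no notation, no axiom; everything over EXISTING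
declarations:

* `adelicDatum F V := UnitaryGroup.adelicGroupData F⁺ K c̄ 3 (Hm V)` (★ `Automorphic/UnitaryGroupAutomorphicRep`) — `U(V)` as an adelic group
  datum over `F⁺`; its finite-adelic points `UnitaryGroup.finAdelic … (Hm V)` ARE the pin's group `↥V.adelicFin` (`HodgeCM/CM/Basic`, the SAME
  declaration) = `(datum413 …).G`; `finToAdelic` (★ `UnitaryGroup.finAdelicToAdelic`), `archToAdelic'` (★ `UnitaryGroup.archToAdelic`);
* `ArchFactor F V` — the ONE hypothesis structure of the two lines (DATA only: `ιinf : U(2,1) →* U(V)(𝔸_{F⁺})` at the indefinite place,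
  `Kc` = the definite archimedean factors) with its DEFINING predicate `ArchFactor.IsHonest` (injective, compact, pairwise commuting with the
  finite-adelic points, product decomposition, `range ιinf ⊔ Kc = range archToAdelic`); existence is P4's `stub_T1_archFactor` ≡ P2's `stub_U0`;
* `rightRep F V` — right translation of `U(V)(𝔸_{F⁺,f})` on `ℂ²`-valued functions on `U(V)(𝔸_{F⁺})`; `smoothFun` (vectors fixed by an open
  subgroup); `conjFun` (componentwise complex conjugation, conjugate-linear);
* `holCotForms 𝔞` — the HOLOMORPHIC COTANGENT AUTOMORPHIC FORMS: left `U(V)(F⁺)`-invariant `ℂ²`-valued functions of right `K_∞`-type the cotangent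
  isotropy representation `weightOf x₀` of `Stab_{U(2,1)}(x₀)` along `ιinf` (★ `weightForms`, ★ `BallForms.cotangentCocycle`; [Borel1997, §5.14]),
  right `K_c`-invariant, smooth, with holomorphic germs along `ιinf` (★ `HodgeCM.Model.holGerms`); `cohForms 𝔞 := holCotForms ⊔ conj holCotForms` —
  the `(1,0) ⊕ (0,1)` cohomological cotangent forms ([BorelWallach2000, VII 2.10/3.6]; for `U(2,1)` the `J^± = π^{1,0}, π^{0,1}` contributions,
  [Liu2021, App. D l. 5274–5276]).

Nothing about [Liu2021] or any crux is asserted here.  HC_CM is proved only modulo the 7 printed citations until rung 0 closes.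

## References
* [BorelJacquet1979] A. Borel, H. Jacquet, Corvallis PSPM 33.1, §4.1–4.2.  [PlatonovRapinchuk1994] §5.1.  [Mok2014] §1 Notation p. 5.
* [Borel1997] A. Borel, *Automorphic forms on SL₂(ℝ)*, §5.14.  [BorelWallach2000] VII 2.10, 3.6.  [Liu2021] App. D l. 5274–5276.
* Tree: ★ `Automorphic/UnitaryGroupAutomorphicRep` (`UnitaryGroup.adelicGroupData`), ★ `UnitaryGroupRestrictedProduct` (`finAdelic`, `finAdelicToAdelic`),
  ★ `UnitaryGroupArchimedean` (`arch`, `archToAdelic`), ★ `Automorphic/WeightForms`, ★ `AutomorphyFactorForms` (`weightOf`), ★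
  `ShimuraVarieties/UnitaryBallAutomorphicForms` (`BallForms.cotangentCocycle`), ★ `Geometry/ComplexHyperbolic/UnitBallU21` (`U21`, `x₀`), ★
  `HodgeCM/Model/ThetaHolGerm` (`IsHolGerm`, `holGerms`), `HodgeCM/CM/Basic` (`HermSpace3.adelicFin`); §3: ★ `Automorphic/UnitaryGroupArchSection`
(`archSectionU21CM`), `Automorphic/UnitaryGroupArchProjectionEmb` (`archProjU21EmbCM`), HodgeCM `Model/BallInstance` (`sylvesterFrame_J`),
`Model/ArchSideInstance` (`toLatticeModelG`, `archInfOf`), `Model/AdelicThetaModuleFin_1` (`finToG`).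

§3 (v2, «AT THE FACTOR OF RECORD»): `archFactorOf F V : ArchFactor F V` — THE archimedean factor the P4/P2 stubs speak about (the tower's
`archInfOf V` in this file's currency); its honesty is proved in `Theorems/P4StubT1ArchFactor.lean`.
-/

set_option autoImplicit false

-- the mandated namespace has the single-problem summit's repeated segment (`HodgeConjecture.HodgeConjecture`)
set_option linter.dupNamespace false

noncomputable section

namespace Summit.HodgeConjecture.HodgeConjecture.Cruxes.H413.CohFormsCarriers

open NumberField MulAction
open Literature.NumberTheory.Automorphic
open Literature.AlgebraicGeometry.ShimuraVarieties
open Literature.Geometry.ComplexHyperbolic.BallModel (U21 x₀)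

/-! ## §1 The concrete adelic group of `U(V)` and the ONE hypothesis structure of the P4/P2 lines: the archimedean factor -/

section Carriers

variable (F : HodgeCM.CMField) {ι₁ : F →+* ℂ} (V : HodgeCM.HermSpace3 F ι₁)

/-- **`𝒢(V) = U(V)` as an adelic group datum over `F⁺`** — the tree's generic `UnitaryGroup.adelicGroupData` at `(F⁺, K, c̄, 3, Hm V)`:
`Adelic = U(Hm V)(𝔸_{F⁺}) ≤ GL₃(𝔸_K)`, `Rational = U(Hm V)(F⁺)`.  Its finite-adelic points `UnitaryGroup.finAdelic … (Hm V)` are the pin's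
group `U(V)(𝔸_{F⁺,f}) = ↥V.adelicFin` (`HodgeCM/CM/Basic`: the SAME declaration), i.e. `(datum413 …).G`.
[cite: Mok2014, §1 Notation p. 5] [cite: Liu2021, §4.2 l. 2060] -/
abbrev adelicDatum : AdelicGroupData ↥(maximalRealSubfield (HodgeCM.CMField.K F)) :=
  UnitaryGroup.adelicGroupData (↥(maximalRealSubfield (HodgeCM.CMField.K F))) (HodgeCM.CMField.K F)
    (IsCMField.complexConj (HodgeCM.CMField.K F)) 3 (HodgeCM.HermSpace3.Hm V)

/-- `U(V)(𝔸_{F⁺,f}) →* U(V)(𝔸_{F⁺})`, `g ↦ (1, g)` (★ `UnitaryGroup.finAdelicToAdelic`). [cite: BorelJacquet1979, §4.1] -/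
abbrev finToAdelic : ↥(HodgeCM.HermSpace3.adelicFin V) →* (adelicDatum F V).Adelic :=
  UnitaryGroup.finAdelicToAdelic (↥(maximalRealSubfield (HodgeCM.CMField.K F))) (HodgeCM.CMField.K F)
    (IsCMField.complexConj (HodgeCM.CMField.K F)) 3 (HodgeCM.HermSpace3.Hm V)

/-- `U(V)(F⁺ ⊗ ℝ) →* U(V)(𝔸_{F⁺})`, `g ↦ (g, 1)` (★ `UnitaryGroup.archToAdelic`). [cite: BorelJacquet1979, §4.1] -/
abbrev archToAdelic' : ↥(UnitaryGroup.arch (↥(maximalRealSubfield (HodgeCM.CMField.K F))) (HodgeCM.CMField.K F)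
      (IsCMField.complexConj (HodgeCM.CMField.K F)) 3 (HodgeCM.HermSpace3.Hm V)) →* (adelicDatum F V).Adelic :=
  UnitaryGroup.archToAdelic (↥(maximalRealSubfield (HodgeCM.CMField.K F))) (HodgeCM.CMField.K F)
    (IsCMField.complexConj (HodgeCM.CMField.K F)) 3 (HodgeCM.HermSpace3.Hm V)

/-- **HYPOTHESIS STRUCTURE of the line (brief §3): an ARCHIMEDEAN FACTOR of `U(V)(𝔸_{F⁺})`** — DATA only: the factor `U(2,1)` at the
indefinite place `ι₁` as a homomorphism `ιinf : U(2,1) →* U(V)(𝔸_{F⁺})` from the tree's real group `U21` of the ball model, and the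
subgroup `Kc` = the product of the (compact) unitary groups `U(3)` at the other real places of `F⁺`.  INTENDED INSTANCE (object-match duty):
HodgeCM's honest archimedean component `archInfOf V` (Sylvester frame at `ι₁`) and its definite-place complement, transported from the
`latticeModel` currency to `UnitaryGroup.adelicGroupData`.  Nothing is asserted by the structure; the defining properties are the predicate
`ArchFactor.IsHonest`, and their satisfiability is `stub_T1_archFactor`. [cite: PlatonovRapinchuk1994, §5.1] [cite: BorelJacquet1979, §4.1] -/
structure ArchFactor : Type where
  /-- the indefinite archimedean factor `U(2,1) = U(V ⊗_{F⁺,ι₁|F⁺} ℝ) →* U(V)(𝔸_{F⁺})` -/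
  ιinf : ↥U21 →* (adelicDatum F V).Adelic
  /-- the definite archimedean factors `∏_{v ∤ ι₁ real} U(V)(F⁺_v) ≅ U(3)^{[F⁺:ℚ]-1}`, as a subgroup of `U(V)(𝔸_{F⁺})` -/
  Kc : Subgroup (adelicDatum F V).Adelic

variable {F V}

/-- **`𝔞.IsHonest`** — the DEFINING properties of the archimedean factorisation `U(V)(𝔸_{F⁺}) = U(2,1) × K_c × U(V)(𝔸_{F⁺,f})`:
the three factors pairwise commute, `ιinf` is injective, `K_c` is compact, every adelic point factors as `ιinf u · k · (1, g)`, and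
`ιinf(U(2,1)) · K_c` is exactly the archimedean part `U(V)(F⁺ ⊗ ℝ) × 1` (★ `UnitaryGroup.archToAdelic`). [cite: PlatonovRapinchuk1994, §5.1]
[cite: BorelJacquet1979, §4.1] -/
def ArchFactor.IsHonest (𝔞 : ArchFactor F V) : Prop :=
  Function.Injective 𝔞.ιinf ∧ IsCompact (𝔞.Kc : Set (adelicDatum F V).Adelic) ∧
    (∀ (u : ↥U21) (k : (adelicDatum F V).Adelic), k ∈ 𝔞.Kc → 𝔞.ιinf u * k = k * 𝔞.ιinf u) ∧
    (∀ (u : ↥U21) (g : ↥(HodgeCM.HermSpace3.adelicFin V)), 𝔞.ιinf u * finToAdelic F V g = finToAdelic F V g * 𝔞.ιinf u) ∧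
    (∀ (k : (adelicDatum F V).Adelic), k ∈ 𝔞.Kc →
      ∀ g : ↥(HodgeCM.HermSpace3.adelicFin V), k * finToAdelic F V g = finToAdelic F V g * k) ∧
    (∀ x : (adelicDatum F V).Adelic, ∃ (u : ↥U21) (k : (adelicDatum F V).Adelic) (g : ↥(HodgeCM.HermSpace3.adelicFin V)),
      k ∈ 𝔞.Kc ∧ x = 𝔞.ιinf u * k * finToAdelic F V g) ∧
    𝔞.ιinf.range ⊔ 𝔞.Kc = (archToAdelic' F V).range

/-! ## §2 Concrete function spaces on `U(V)(𝔸_{F⁺})`: right translation, smooth vectors, (anti)holomorphic cotangent automorphic forms -/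

variable (F V) in
/-- **Right translation by the finite-adelic group** on `ℂ²`-valued functions on `U(V)(𝔸_{F⁺})`: `(R_g f)(x) = f (x · (1, g))`.
[cite: BorelJacquet1979, §4.2] -/
def rightRep : Representation ℂ ↥(HodgeCM.HermSpace3.adelicFin V) ((adelicDatum F V).Adelic → (Fin 2 → ℂ)) where
  toFun g :=
    { toFun := fun f x => f (x * finToAdelic F V g)
      map_add' := fun _ _ => rfl
      map_smul' := fun _ _ => rfl }
  map_one' := by
    ext f x
    simp
  map_mul' g g' := by
    ext f x
    simp [mul_assoc]

variable (F V) in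
/-- **Smooth vectors** for the finite-adelic right translation: functions fixed by some OPEN subgroup of `U(V)(𝔸_{F⁺,f})`
(the sum over open `K_f` of the `K_f`-invariants). [cite: BorelJacquet1979, §4.2 (right `K`-finiteness)] -/
def smoothFun : Submodule ℂ ((adelicDatum F V).Adelic → (Fin 2 → ℂ)) :=
  ⨆ (Kf : Subgroup ↥(HodgeCM.HermSpace3.adelicFin V)) (_ : IsOpen (Kf : Set ↥(HodgeCM.HermSpace3.adelicFin V))),
    Representation.invariants ((rightRep F V).comp Kf.subtype)

variable (F V) in
/-- Componentwise complex conjugation of `ℂ²`-valued functions, a conjugate-linear map (sends holomorphic germs to anti-holomorphic ones).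
[cite: BorelWallach2000, VII 2.10] -/
def conjFun : ((adelicDatum F V).Adelic → (Fin 2 → ℂ)) →ₛₗ[starRingEnd ℂ] ((adelicDatum F V).Adelic → (Fin 2 → ℂ)) where
  toFun f := fun x => star (f x)
  map_add' f f' := by
    funext x
    simp [star_add]
  map_smul' c f := by
    funext x
    ext j
    simp

/-- **The HOLOMORPHIC COTANGENT AUTOMORPHIC FORMS of `U(V)` for the archimedean factor `𝔞`** (`(1,0)`-forms of all levels on the ball
quotients `P_Γ(V)`, read on the group): `ℂ²`-valued functions on `U(V)(𝔸_{F⁺})` that are (i) LEFT-invariant under `U(V)(F⁺)` and of RIGHT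
`K_∞`-type the cotangent isotropy representation `weightOf x₀` of `Stab_{U(2,1)}(x₀) ≅ U(2) × U(1)` along `ιinf` (★ `weightForms`, [Borel1997,
§5.14]; ★ `BallForms.cotangentCocycle`), (ii) right-invariant under the definite factor `K_c`, (iii) smooth under `U(V)(𝔸_{F⁺,f})`, and
(iv) with HOLOMORPHIC germs along `ιinf` (★ `HodgeCM.Model.holGerms`). [cite: Borel1997, §5.14] [cite: BorelWallach2000, VII 2.10 and 3.6]
[cite: BorelJacquet1979, §4.2] -/
def holCotForms (𝔞 : ArchFactor F V) : Submodule ℂ ((adelicDatum F V).Adelic → (Fin 2 → ℂ)) :=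
  Literature.NumberTheory.Automorphic.weightForms (adelicDatum F V).toAdelic.range
      (𝔞.ιinf.comp (stabilizer (↥U21) x₀).subtype) (BallForms.isPullbackCocycle_cotangentCocycle.weightOf x₀) ⊓
    { carrier := {f | ∀ k ∈ 𝔞.Kc, ∀ x, f (x * k) = f x}
      add_mem' := fun hf hf' k hk x => by simp only [Pi.add_apply, hf k hk x, hf' k hk x]
      zero_mem' := fun _ _ _ => rfl
      smul_mem' := fun c f hf k hk x => by simp only [Pi.smul_apply, hf k hk x] } ⊓
    smoothFun F V ⊓ HodgeCM.Model.holGerms 𝔞.ιinf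

/-- **The `(1,0) ⊕ (0,1)` COHOMOLOGICAL COTANGENT AUTOMORPHIC FORMS**: holomorphic cotangent forms and their complex conjugates (the two Hodge
types of degree `1` on the ball quotients; [BorelWallach2000, VII 2.10/3.6] bigrading; for `U(2,1)` these are the contributions of `J⁺ = π^{1,0}`
and `J⁻ = π^{0,1}`, [Liu2021, l. 5274–5276]). [cite: BorelWallach2000, VII 2.10 and 3.6] [cite: Liu2021, App. D l. 5274–5276] -/
def cohForms (𝔞 : ArchFactor F V) : Submodule ℂ ((adelicDatum F V).Adelic → (Fin 2 → ℂ)) :=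
  holCotForms 𝔞 ⊔ (holCotForms 𝔞).map (conjFun F V)

end Carriers

/-! ## §3 The archimedean factor OF RECORD `𝔞₀(V)` (P4 v2 / P2: the stubs speak about THIS factor; its honesty — all seven clauses of
`ArchFactor.IsHonest` — is the THEOREM `archFactorOf_isHonest` of `Theorems/P4StubT1ArchFactor.lean`, not a stub) -/

section OfRecord

variable (F : HodgeCM.CMField) {ι₁ : F →+* ℂ} (V : HodgeCM.HermSpace3 F ι₁)

/-- **The archimedean factor of record `𝔞₀(V) = (ιinf, K_c)`**: `ιinf :=` the CM archimedean SECTION `U(2,1) →* U(V)(𝔸_{F⁺})` at `ι₁`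
through HodgeCM's uniform Sylvester frame `V.sylvesterFrame` (★ `UnitaryGroup.archSectionU21CM`, frame identity ★
`HodgeCM.Model.sylvesterFrame_J`) — BY CONSTRUCTION the archimedean component of the HodgeCM tower read in the regime model,
`toLatticeModelG V ∘ ιinf = HodgeCM.Model.archInfOf V` (★ `archInfOf_apply`), just as `toLatticeModelG V ∘ finToAdelic = finToG V hV`
(★ `finToG_eq_toLatticeModelG`) — and `K_c :=` the archimedean elements with trivial `ι₁`-component,
`(ker ★ archProjU21EmbCM).map archToAdelic ≅ ∏_{w ≠ w(ι₁)} U(σ_w Hm V)(ℂ)` (compact: the form is definite there, [PlatonovRapinchuk1994,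
§3.2 Thm 3.1]).  [cite: BorelJacquet1979, §4.1] [cite: PlatonovRapinchuk1994, §3.2 Thm 3.1; §5.1] -/
def archFactorOf : ArchFactor F V where
  ιinf := UnitaryGroup.archSectionU21CM (HodgeCM.CMField.K F) ι₁ (HodgeCM.HermSpace3.Hm V) V.sylvesterFrame
    (HodgeCM.Model.sylvesterFrame_J V)
  Kc := (UnitaryGroup.archProjU21EmbCM (HodgeCM.CMField.K F) (HodgeCM.HermSpace3.Hm V) ι₁ V.sylvesterFrame
      (UnitaryGroup.formCongr_eq_of_conjTranspose (HodgeCM.CMField.K F) ι₁ (HodgeCM.HermSpace3.Hm V) V.sylvesterFrame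
        (HodgeCM.Model.sylvesterFrame_J V))).ker.map (archToAdelic' F V)

/-- `𝔞₀(V).ιinf` is the CM archimedean section through `V.sylvesterFrame` (`rfl`). [cite: BorelJacquet1979, §4.1] -/
theorem archFactorOf_ιinf : (archFactorOf F V).ιinf =
    UnitaryGroup.archSectionU21CM (HodgeCM.CMField.K F) ι₁ (HodgeCM.HermSpace3.Hm V) V.sylvesterFrame
      (HodgeCM.Model.sylvesterFrame_J V) := rfl

/-- `𝔞₀(V).K_c` is the image in `U(V)(𝔸_{F⁺})` of the kernel of the archimedean projection at `ι₁` (`rfl`). [cite: BorelJacquet1979, §4.1] -/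
theorem archFactorOf_Kc : (archFactorOf F V).Kc =
    (UnitaryGroup.archProjU21EmbCM (HodgeCM.CMField.K F) (HodgeCM.HermSpace3.Hm V) ι₁ V.sylvesterFrame
      (UnitaryGroup.formCongr_eq_of_conjTranspose (HodgeCM.CMField.K F) ι₁ (HodgeCM.HermSpace3.Hm V) V.sylvesterFrame
        (HodgeCM.Model.sylvesterFrame_J V))).ker.map (archToAdelic' F V) := rfl

/-- `𝔞₀(V).ιinf` is injective (★ `archSectionU21CM_injective`). [cite: BorelJacquet1979, §4.1] -/
theorem archFactorOf_ιinf_injective : Function.Injective (archFactorOf F V).ιinf :=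
  UnitaryGroup.archSectionU21CM_injective (HodgeCM.CMField.K F) ι₁ (HodgeCM.HermSpace3.Hm V) V.sylvesterFrame
    (HodgeCM.Model.sylvesterFrame_J V)

/-- **TRANSPORT TO THE TOWER'S CURRENCY, archimedean factor**: read in the regime model `(V.latticeModel _).G` through HodgeCM's
`toLatticeModelG V`, the factor of record IS the tower's archimedean component `archInfOf V` (★ `HodgeCM.Model.archInfOf_apply`; `rfl`).
This is what lets T2′ transport the theta instance's `compAt`/`compClass`/`towerFamily_mem` to general cotangent forms. [cite: BorelJacquet1979, §4.1] -/
theorem toLatticeModelG_archFactorOf_ιinf (u : ↥U21) :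
    HodgeCM.Model.toLatticeModelG V ((archFactorOf F V).ιinf u) = HodgeCM.Model.archInfOf V u := rfl

/-- **TRANSPORT TO THE TOWER'S CURRENCY, finite-adelic factor**: `toLatticeModelG V (1, g) = finToG V hV g` (★ `HodgeCM.Model.finToG_eq_toLatticeModelG`).
[cite: BorelJacquet1979, §4.1] -/
theorem toLatticeModelG_finToAdelic (hV : HodgeCM.IsAnisotropic F (HodgeCM.HermSpace3.Hm V))
    (g : ↥(HodgeCM.HermSpace3.adelicFin V)) :
    HodgeCM.Model.toLatticeModelG V (finToAdelic F V g) = HodgeCM.Model.finToG V hV g :=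
  (HodgeCM.Model.finToG_eq_toLatticeModelG V hV g).symm

end OfRecord

end Summit.HodgeConjecture.HodgeConjecture.Cruxes.H413.CohFormsCarriers

end
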